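import Summits.NavierStokesRegularity.NavierStokesRegularity.Theorems.EulerZoomLiouvillePowerGaugeEulerLiouvilleProfileEnergyPointwise
import Summits.NavierStokesRegularity.NavierStokesRegularity.Theorems.EulerZoomLiouvillePowerGaugeEulerLiouvilleSpiralProfileEnergyFixedN
import Summits.NavierStokesRegularity.NavierStokesRegularity.Theorems.EulerZoomLiouvillePowerGaugeEulerLiouvilleSpiralProfileEnergyPointwise

/-!
# Spiral (O(3)-twisted) self-similar profiles: the RADIAL PROFILE LOCAL ENERGY EQUALITY
# (crux `EulerZoomLiouville.PowerGaugeEulerLiouville` = stmt-NavierStokesRegularity-19832; line `relative_equilibria`, brick R3a-P7, file 3/4)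

Route `EulerZoomLiouville` (NavierStokesRegularity); width seat ns-ezl-w3 g9, LEAD 19832 ns-typeII-p2 g17 KEY «R3a-P7»; recipe ns-idea-11 g11/g12
`Cruxes/PowerGaugeEulerLiouville/Lines/relative-equilibria.md` l.139–143 (P7).  `--supports` stmt-19832.

MAIN THEOREM `Spiral.profile_local_energy_equality` = `ProfileEnergy.profile_local_energy_equality` (the untwisted brick) with the two
linear terms of the spiral ansatz threaded through: let `V : ℝ³ → ℝ³` have a weak derivative `G` on the whole space with `V ∈ L⁶_loc`,
`G ∈ L²_loc`, `P ∈ L^{3/2}_loc`, `V` weakly divergence free, `S : ℝ³ →L ℝ³` trace-free, and let `(V,P)` solve the SPIRAL profile equation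
`(1−γ)V − SV + DV[γy + Sy + V] + ∇P = 0` in the weak form (brick P6's output)
`∫ ⟪V,(V·∇)ψ⟫ + P div ψ + γ⟪V,(y·∇)ψ⟫ + ⟪V,(Sy·∇)ψ⟫ + (4γ−1)⟪V,ψ⟫ + ⟪SV,ψ⟫ = 0` for all `ψ ∈ C_c^∞(ℝ³;ℝ³)`.  Then for every `σ ∈ C_c^∞(ℝ³)`

  `(2 − 5γ) ∫ σ|V|² = ∫ (|V|² + 2P)⟪V, ∇σ⟫ + γ ∫ |V|²⟪y, ∇σ⟫ + ∫ |V|²⟪Sy, ∇σ⟫ + 2∫ σ⟪SV, V⟫.`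

(proof = the untwisted limit passage with `Spiral.integral_integrandN_eq_zero` at fixed level; the S-extras sit in the free `a₅,a₆,a₇` of
`ProfileEnergy.eLpNorm_weight_le`).  Radial corollary (skew `S`, radial-gradient `σ` ⇒ untwisted LEE verbatim = R3a's clause): file 4.
WHAT THIS IS NOT: not NS regularity, not the crux — a port of a C1 tool to the spiral stratum of the MODEL-lattice crux class;
19832 OPEN. [folklore; cf. ChaeShvydkoy2013 §2.2 eq. (2.9)]
-/

noncomputable section

set_option linter.dupNamespace false

open MeasureTheory Set Filter Topology Metric Function TopologicalSpace
open scoped ENNReal NNReal RealInnerProductSpace ContDiff Convolution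

namespace Summit.NavierStokesRegularity.NavierStokesRegularity.Theorems.PowerGaugeEulerLiouville

open Literature.Analysis Literature.Analysis.FunctionSpaces Literature.Analysis.FluidPDE
open Summit.NavierStokesRegularity.NavierStokesRegularity.Theorems.PowerGaugeEulerLiouville.ProfileEnergy

namespace Spiral

/-! ## The spiral local energy equality -/

section Main

-- one monolithic limit passage (as the untwisted twin) plus the S-extras: the default heartbeat budget does not suffice
set_option maxHeartbeats 800000 in
/-- **SPIRAL PROFILE LOCAL ENERGY EQUALITY for weak spiral self-similar Euler profiles in `H¹_loc`** (P7 of line `relative_equilibria`):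
`V ∈ L⁶_loc` with weak gradient `G ∈ L²_loc`, `P ∈ L^{3/2}_loc`, `V` weakly divergence free, `S` trace-free, and the spiral weak profile
equation ⇒ for every scalar test function `σ`,
`(2 − 5γ) ∫ σ|V|² = ∫ (|V|² + 2P)⟪V, ∇σ⟫ + γ ∫ |V|² ⟪y, ∇σ⟫ + ∫ |V|²⟪Sy, ∇σ⟫ + 2 ∫ σ⟪SV, V⟫`.
[folklore; cf. ChaeShvydkoy2013 §2.2 eq. (2.9)] -/
theorem profile_local_energy_equality {γ : ℝ}
    {V : EuclideanSpace ℝ (Fin 3) → EuclideanSpace ℝ (Fin 3)} {P : EuclideanSpace ℝ (Fin 3) → ℝ}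
    {G : EuclideanSpace ℝ (Fin 3) → EuclideanSpace ℝ (Fin 3) →L[ℝ] EuclideanSpace ℝ (Fin 3)}
    (hVG : HasWeakFDerivOn (⊤ : Opens (EuclideanSpace ℝ (Fin 3))) volume V G)
    (hV6 : ∀ r : ℝ, MemLp V 6 (volume.restrict (ball (0 : EuclideanSpace ℝ (Fin 3)) r)))
    (hG2 : ∀ r : ℝ, MemLp G 2 (volume.restrict (ball (0 : EuclideanSpace ℝ (Fin 3)) r)))
    (hPm : AEStronglyMeasurable P volume)
    (hP : ∀ r : ℝ, MemLp P (3 / 2 : ℝ≥0∞) (volume.restrict (ball (0 : EuclideanSpace ℝ (Fin 3)) r)))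
    (hdiv : IsWeaklyDivFree V) {S : EuclideanSpace ℝ (Fin 3) →L[ℝ] EuclideanSpace ℝ (Fin 3)}
    (hS0 : LinearMap.trace ℝ (EuclideanSpace ℝ (Fin 3)) (S : EuclideanSpace ℝ (Fin 3) →ₗ[ℝ] EuclideanSpace ℝ (Fin 3)) = 0)
    (heq : ∀ ψ : EuclideanSpace ℝ (Fin 3) → EuclideanSpace ℝ (Fin 3),
      IsTestFunctionOn (⊤ : Opens (EuclideanSpace ℝ (Fin 3))) ψ →
        ∫ x, (⟪V x, fderiv ℝ ψ x (V x)⟫ + P x * VectorCalculus.divergence ψ x +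
          γ * ⟪V x, fderiv ℝ ψ x x⟫ + ⟪V x, fderiv ℝ ψ x (S x)⟫ + (4 * γ - 1) * ⟪V x, ψ x⟫ + ⟪S (V x), ψ x⟫) = 0)
    {σ : EuclideanSpace ℝ (Fin 3) → ℝ} (hσ : IsTestFunctionOn (⊤ : Opens (EuclideanSpace ℝ (Fin 3))) σ) :
    (2 - 5 * γ) * ∫ x, σ x * ‖V x‖ ^ 2 =
      (∫ x, (‖V x‖ ^ 2 + 2 * P x) * ⟪V x, gradient σ x⟫) +
        γ * (∫ x, ‖V x‖ ^ 2 * ⟪x, gradient σ x⟫) +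
        (∫ x, ‖V x‖ ^ 2 * ⟪S x, gradient σ x⟫) + 2 * ∫ x, σ x * ⟪S (V x), V x⟫ := by
  /- ### Step 0. Supports, constants -/
  obtain ⟨R₀, hR₀⟩ := hσ.hasCompactSupport.isCompact.isBounded.subset_ball (0 : EuclideanSpace ℝ (Fin 3))
  set R : ℝ := max R₀ 1 with hRdef
  have hR1 : 1 ≤ R := le_max_right _ _
  have hRpos : 0 < R := lt_of_lt_of_le one_pos hR1
  set K : Set (EuclideanSpace ℝ (Fin 3)) := tsupport σ with hKdef
  have hKc : IsCompact K := hσ.hasCompactSupport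
  have hKm : MeasurableSet K := (isClosed_tsupport σ).measurableSet
  have hKR : K ⊆ ball (0 : EuclideanSpace ℝ (Fin 3)) R := hR₀.trans (ball_subset_ball (le_max_left _ _))
  set S₀ : Set (EuclideanSpace ℝ (Fin 3)) := ball (0 : EuclideanSpace ℝ (Fin 3)) (R + 1) with hS₀def
  set B : Set (EuclideanSpace ℝ (Fin 3)) := ball (0 : EuclideanSpace ℝ (Fin 3)) (R + 2) with hBdef
  have hKS : K ⊆ S₀ := hKR.trans (ball_subset_ball (by linarith))
  have hSB : S₀ ⊆ B := ball_subset_ball (by linarith)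
  have hKB : K ⊆ B := hKS.trans hSB
  have hSm : MeasurableSet S₀ := measurableSet_ball
  have hBm : MeasurableSet B := measurableSet_ball
  have hxK : ∀ x ∈ K, ‖x‖ ≤ R := fun x hx => by
    have := hKR hx; rw [mem_ball, dist_zero_right] at this; exact this.le
  have hσK : ∀ x, x ∉ K → σ x = 0 := fun x hx => image_eq_zero_of_notMem_tsupport hx
  have hDσK : ∀ x, x ∉ K → fderiv ℝ σ x = 0 := fun x hx =>
    notMem_support.1 fun h => hx (support_fderiv_subset ℝ h)
  have hσd : Differentiable ℝ σ := hσ.contDiff.differentiable (by simp)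
  have hσc : Continuous σ := hσ.contDiff.continuous
  have hDσc : Continuous (fderiv ℝ σ) := hσ.contDiff.continuous_fderiv (by simp)
  obtain ⟨Cσ, hCσ⟩ := hσc.bounded_above_of_compact_support hσ.hasCompactSupport
  obtain ⟨Cσ', hCσ'⟩ := hDσc.bounded_above_of_compact_support (hσ.hasCompactSupport.fderiv (𝕜 := ℝ))
  have hCσ0 : 0 ≤ Cσ := (norm_nonneg _).trans (hCσ 0)
  have hCσ'0 : 0 ≤ Cσ' := (norm_nonneg _).trans (hCσ' 0)
  /- ### Step 1. Truncations and integrability -/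
  haveI hBfin : IsFiniteMeasure ((volume : Measure (EuclideanSpace ℝ (Fin 3))).restrict B) :=
    isFiniteMeasure_restrict.2 measure_ball_lt_top.ne
  set Vt : EuclideanSpace ℝ (Fin 3) → EuclideanSpace ℝ (Fin 3) := B.indicator V with hVtdef
  set Pt : EuclideanSpace ℝ (Fin 3) → ℝ := B.indicator P with hPtdef
  have hV6B : MemLp V 6 (volume.restrict B) := hV6 (R + 2)
  have hV3B : MemLp V 3 (volume.restrict B) := hV6B.mono_exponent (by norm_num)
  have hV2B : MemLp V 2 (volume.restrict B) := hV6B.mono_exponent (by norm_num)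
  have hV32B : MemLp V (3 / 2 : ℝ≥0∞) (volume.restrict B) := hV6B.mono_exponent threeHalves_le_six
  have hV1B : MemLp V 1 (volume.restrict B) := hV6B.mono_exponent (by norm_num)
  have hVt6 : MemLp Vt 6 volume := (memLp_indicator_iff_restrict hBm).2 hV6B
  have hVt3 : MemLp Vt 3 volume := (memLp_indicator_iff_restrict hBm).2 hV3B
  have hVt2 : MemLp Vt 2 volume := (memLp_indicator_iff_restrict hBm).2 hV2B
  have hVt32 : MemLp Vt (3 / 2 : ℝ≥0∞) volume := (memLp_indicator_iff_restrict hBm).2 hV32B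
  have hP32B : MemLp P (3 / 2 : ℝ≥0∞) (volume.restrict B) := hP (R + 2)
  have hPt32 : MemLp Pt (3 / 2 : ℝ≥0∞) volume := (memLp_indicator_iff_restrict hBm).2 hP32B
  have hG2B : MemLp G 2 (volume.restrict B) := hG2 (R + 2)
  have hVtB : ∀ x ∈ B, Vt x = V x := fun x hx => indicator_of_mem hx _
  have hPtB : ∀ x ∈ B, Pt x = P x := fun x hx => indicator_of_mem hx _
  have hVloc : LocallyIntegrable V volume := locallyIntegrableOn_univ.1 (by
    simpa only [Opens.coe_top] using hVG.locallyIntegrableOn)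
  have hVm : AEStronglyMeasurable V volume := hVloc.aestronglyMeasurable
  have hVi : IntegrableOn V B volume := memLp_one_iff_integrable.1 hV1B
  have hGi : IntegrableOn G B volume := memLp_one_iff_integrable.1 (hG2B.mono_exponent one_le_two)
  have hNG : eLpNorm G 2 (volume.restrict B) < ⊤ := hG2B.eLpNorm_lt_top
  /- ### Step 2. Mollifiers -/
  obtain ⟨φ, hφr, -⟩ := exists_contDiffBump_seq (E := EuclideanSpace ℝ (Fin 3))
  have hr1 : ∀ᶠ n in atTop, (φ n).rOut ≤ 1 :=
    (hφr.eventually (gt_mem_nhds one_pos)).mono fun n hn => hn.le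
  set W : ℕ → EuclideanSpace ℝ (Fin 3) → EuclideanSpace ℝ (Fin 3) := fun n =>
    (φ n).normed volume ⋆[ContinuousLinearMap.lsmul ℝ ℝ, volume] Vt with hWdef
  have hWs : ∀ n, ContDiff ℝ ∞ (W n) := fun n => contDiff_normed_convolution_indicator (φ n) hVloc (R + 2)
  have hWd : ∀ n, Differentiable ℝ (W n) := fun n => (hWs n).differentiable (by simp)
  have hWc : ∀ n, Continuous (W n) := fun n => (hWs n).continuous
  have hDWc : ∀ n, Continuous (fderiv ℝ (W n)) := fun n => (hWs n).continuous_fderiv (by simp)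
  have hWdiv : ∀ n, (φ n).rOut ≤ 1 → ∀ x ∈ S₀, VectorCalculus.divergence (W n) x = 0 :=
    fun n hn x hx => divergence_normed_convolution_indicator_eq_zero (φ n) hn hVloc hdiv hx
  have hDW2 : ∀ n, (φ n).rOut ≤ 1 →
      eLpNorm (S₀.indicator fun x => ‖fderiv ℝ (W n) x‖) 2 volume ≤ eLpNorm G 2 (volume.restrict B) := by
    intro n hn
    rw [eLpNorm_indicator_eq_eLpNorm_restrict hSm, eLpNorm_norm]
    exact eLpNorm_fderiv_normed_convolution_indicator_ball_le (φ n) hn hVG hVi hGi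
  have hW3 : ∀ n, eLpNorm (W n) 3 volume ≤ eLpNorm Vt 3 volume := fun n =>
    eLpNorm_normed_convolution_le (φ n) hVt3.1 (by norm_num)
  have hW32 : ∀ n, eLpNorm (W n) (3 / 2 : ℝ≥0∞) volume ≤ eLpNorm Vt (3 / 2 : ℝ≥0∞) volume := fun n =>
    eLpNorm_normed_convolution_le (φ n) hVt32.1
      (by rw [ENNReal.le_div_iff_mul_le (Or.inl (by norm_num)) (Or.inl (by norm_num))]; norm_num)
  have hlim : Tendsto (fun n => eLpNorm (W n - Vt) 3 volume) atTop (𝓝 0) :=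
    tendsto_eLpNorm_normed_convolution_sub_self (μ := (volume : Measure (EuclideanSpace ℝ (Fin 3))))
      hφr (by norm_num) (by norm_num) hVt3
  /- ### Step 3. The identity at fixed `n` -/
  have hV2K : IntegrableOn (fun x => ‖V x‖ ^ 2) K volume :=
    IntegrableOn.mono_set (show IntegrableOn (fun x => ‖V x‖ ^ 2) B volume from
      hV2B.integrable_norm_pow (by norm_num)) hKB
  have hV1K : IntegrableOn (fun x => ‖V x‖) K volume :=
    IntegrableOn.mono_set (show IntegrableOn (fun x => ‖V x‖) B volume from
      (memLp_one_iff_integrable.1 hV1B).norm) hKB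
  have hP1K : IntegrableOn (fun x => |P x|) K volume := by
    have h : IntegrableOn P B volume := memLp_one_iff_integrable.1 (hP32B.mono_exponent
      (by rw [ENNReal.le_div_iff_mul_le (Or.inl (by norm_num)) (Or.inl (by norm_num))]; norm_num))
    exact (h.mono_set hKB).abs
  obtain ⟨In, hIndef⟩ : ∃ f : ℕ → EuclideanSpace ℝ (Fin 3) → ℝ, f = fun n x =>
      ((fderiv ℝ σ x) (V x) * ⟪(V x), (W n x)⟫ + (σ x) * ⟪(V x), (fderiv ℝ (W n) x) (V x)⟫ + (P x) * (fderiv ℝ σ x) (W n x) +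
          γ * ((fderiv ℝ σ x) x * ⟪(V x), (W n x)⟫ + (σ x) * ⟪(V x), (fderiv ℝ (W n) x) x⟫) + (4 * γ - 1) * ((σ x) * ⟪(V x), (W n x)⟫) -
          ((1 / 2 : ℝ) * ((fderiv ℝ σ x) (V x) * ‖(W n x)‖ ^ 2) + (σ x) * ⟪(W n x), (fderiv ℝ (W n) x) (V x)⟫) -
          γ * ((1 / 2 : ℝ) * ((fderiv ℝ σ x) x * ‖(W n x)‖ ^ 2) + (σ x) * ⟪(W n x), (fderiv ℝ (W n) x) x⟫ + 3 * ((1 / 2 : ℝ) * ((σ x) * ‖(W n x)‖ ^ 2)))) +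
          (((fderiv ℝ σ x) (S x) * ⟪(V x), (W n x)⟫ + (σ x) * ⟪(V x), (fderiv ℝ (W n) x) (S x)⟫ + (σ x) * ⟪S (V x), (W n x)⟫) -
            ((1 / 2 : ℝ) * ((fderiv ℝ σ x) (S x) * ‖(W n x)‖ ^ 2) + (σ x) * ⟪(W n x), (fderiv ℝ (W n) x) (S x)⟫)) := ⟨_, rfl⟩
  have hIn : ∀ᶠ n in atTop, Integrable (In n) volume ∧ ∫ x, In n x = 0 := by
    filter_upwards [hr1] with n hn
    rw [hIndef]
    exact Spiral.integral_integrandN_eq_zero hVm hPm hσ hKS hxK hRpos.le hCσ hCσ' (hWs n) (hWdiv n hn)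
      hV2K hV1K hP1K hdiv hS0 heq
  /- ### Step 4. The limit integrand and its integrability -/
  obtain ⟨Ilim, hIlimdef⟩ : ∃ f : EuclideanSpace ℝ (Fin 3) → ℝ, f = fun x =>
      ((1 / 2 : ℝ) * ((fderiv ℝ σ x) (V x) * ‖(V x)‖ ^ 2) + (P x) * (fderiv ℝ σ x) (V x) + γ * ((1 / 2 : ℝ) * ((fderiv ℝ σ x) x * ‖(V x)‖ ^ 2)) +
          (5 / 2 * γ - 1) * ((σ x) * ‖(V x)‖ ^ 2)) +
        ((1 / 2 : ℝ) * ((fderiv ℝ σ x) (S x) * ‖(V x)‖ ^ 2) + (σ x) * ⟪S (V x), (V x)⟫) := ⟨_, rfl⟩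
  have hin : ∀ a b : EuclideanSpace ℝ (Fin 3), |⟪a, b⟫| ≤ ‖a‖ * ‖b‖ := fun a b => abs_real_inner_le_norm a b
  have hdV : ∀ x, |fderiv ℝ σ x (V x)| ≤ Cσ' * ‖V x‖ := fun x =>
    (Real.norm_eq_abs _ ▸ (fderiv ℝ σ x).le_opNorm _).trans (mul_le_mul_of_nonneg_right (hCσ' x) (norm_nonneg _))
  have hdx : ∀ x ∈ K, |fderiv ℝ σ x x| ≤ Cσ' * R := fun x hx =>
    (Real.norm_eq_abs _ ▸ (fderiv ℝ σ x).le_opNorm _).trans (mul_le_mul (hCσ' x) (hxK x hx) (norm_nonneg _) hCσ'0)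
  have hsx : ∀ x, |σ x| ≤ Cσ := fun x => (Real.norm_eq_abs _).symm.le.trans (hCσ x)
  -- the four pieces of the limit integrand are integrable
  have hV3K : IntegrableOn (fun x => ‖V x‖ ^ 3) K volume :=
    IntegrableOn.mono_set (show IntegrableOn (fun x => ‖V x‖ ^ 3) B volume from
      hV3B.integrable_norm_pow (by norm_num)) hKB
  have hPVK : IntegrableOn (fun x => |P x| * ‖V x‖) K volume := by
    haveI : ENNReal.HolderTriple (3 / 2 : ℝ≥0∞) 3 1 := by
      refine ⟨?_⟩
      rw [ENNReal.inv_div (Or.inr (by norm_num)) (Or.inr (by norm_num)), inv_one]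
      have e3 : (3 : ℝ≥0∞)⁻¹ = ((3⁻¹ : ℝ≥0) : ℝ≥0∞) := by rw [ENNReal.coe_inv (by norm_num)]; norm_num
      have e23 : (2 / 3 : ℝ≥0∞) = ((2 / 3 : ℝ≥0) : ℝ≥0∞) := by rw [ENNReal.coe_div (by norm_num)]; norm_num
      rw [e3, e23, ← ENNReal.coe_add, ← ENNReal.coe_one, ENNReal.coe_inj]
      norm_num
    have h1 : MemLp (fun x => |P x|) (3 / 2 : ℝ≥0∞) (volume.restrict B) := hP32B.abs
    have h2 : MemLp (fun x => ‖V x‖) 3 (volume.restrict B) := hV3B.norm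
    have h3 : MemLp (fun x => |P x| * ‖V x‖) 1 (volume.restrict B) := by
      have := MemLp.mul (p := (3 / 2 : ℝ≥0∞)) (q := 3) (r := 1) h2 h1
      simpa [Pi.mul_def, mul_comm] using this
    exact IntegrableOn.mono_set (memLp_one_iff_integrable.1 h3) hKB
  have hj1 : Integrable (fun x => ‖V x‖ ^ 2 * fderiv ℝ σ x (V x)) volume := by
    refine integrable_of_abs_le_on hKm ?_ hV3K (C := Cσ') (fun x hx => ?_) (fun x hx => ?_)
    · exact ((hVm.norm.pow 2).mul (aestronglyMeasurable_clm_apply hDσc.aestronglyMeasurable hVm))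
    · rw [abs_mul, abs_pow, abs_norm, abs_of_nonneg (by positivity : (0 : ℝ) ≤ ‖V x‖ ^ 3)]
      calc ‖V x‖ ^ 2 * |fderiv ℝ σ x (V x)| ≤ ‖V x‖ ^ 2 * (Cσ' * ‖V x‖) :=
            mul_le_mul_of_nonneg_left (hdV x) (by positivity)
        _ = Cσ' * ‖V x‖ ^ 3 := by ring
    · simp [hDσK x hx]
  have hj2 : Integrable (fun x => P x * fderiv ℝ σ x (V x)) volume := by
    refine integrable_of_abs_le_on hKm ?_ hPVK (C := Cσ') (fun x hx => ?_) (fun x hx => ?_)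
    · exact hPm.mul (aestronglyMeasurable_clm_apply hDσc.aestronglyMeasurable hVm)
    · rw [abs_mul, abs_of_nonneg (by positivity : 0 ≤ |P x| * ‖V x‖)]
      calc |P x| * |fderiv ℝ σ x (V x)| ≤ |P x| * (Cσ' * ‖V x‖) := mul_le_mul_of_nonneg_left (hdV x) (abs_nonneg _)
        _ = Cσ' * (|P x| * ‖V x‖) := by ring
    · simp [hDσK x hx]
  have hj3 : Integrable (fun x => ‖V x‖ ^ 2 * fderiv ℝ σ x x) volume := by
    refine integrable_of_abs_le_on hKm ?_ hV2K (C := Cσ' * R) (fun x hx => ?_) (fun x hx => ?_)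
    · exact (hVm.norm.pow 2).mul (hDσc.clm_apply continuous_id).aestronglyMeasurable
    · rw [abs_mul, abs_pow, abs_norm]
      calc ‖V x‖ ^ 2 * |fderiv ℝ σ x x| ≤ ‖V x‖ ^ 2 * (Cσ' * R) := mul_le_mul_of_nonneg_left (hdx x hx) (by positivity)
        _ = Cσ' * R * ‖V x‖ ^ 2 := by ring
    · simp [hDσK x hx]
  have hj4 : Integrable (fun x => σ x * ‖V x‖ ^ 2) volume := by
    refine integrable_of_abs_le_on hKm ?_ hV2K (C := Cσ) (fun x hx => ?_) (fun x hx => ?_)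
    · exact hσc.aestronglyMeasurable.mul (hVm.norm.pow 2)
    · rw [abs_mul, abs_pow, abs_norm]
      exact mul_le_mul_of_nonneg_right (hsx x) (by positivity)
    · simp [hσK x hx]
  have hdxS : ∀ x ∈ K, |fderiv ℝ σ x (S x)| ≤ Cσ' * (‖S‖ * R) := fun x hx =>
    (Real.norm_eq_abs _ ▸ (fderiv ℝ σ x).le_opNorm _).trans (mul_le_mul (hCσ' x)
      ((S.le_opNorm x).trans (mul_le_mul_of_nonneg_left (hxK x hx) (norm_nonneg _))) (norm_nonneg _) hCσ'0)
  have hj5 : Integrable (fun x => ‖V x‖ ^ 2 * fderiv ℝ σ x (S x)) volume := by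
    refine integrable_of_abs_le_on hKm ?_ hV2K (C := Cσ' * (‖S‖ * R)) (fun x hx => ?_) (fun x hx => ?_)
    · exact (hVm.norm.pow 2).mul (hDσc.clm_apply S.continuous).aestronglyMeasurable
    · rw [abs_mul, abs_pow, abs_norm]
      calc ‖V x‖ ^ 2 * |fderiv ℝ σ x (S x)| ≤ ‖V x‖ ^ 2 * (Cσ' * (‖S‖ * R)) :=
            mul_le_mul_of_nonneg_left (hdxS x hx) (by positivity)
        _ = Cσ' * (‖S‖ * R) * ‖V x‖ ^ 2 := by ring
    · simp [hDσK x hx]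
  have hj6 : Integrable (fun x => σ x * ⟪S (V x), V x⟫) volume := by
    refine integrable_of_abs_le_on hKm ?_ hV2K (C := Cσ * ‖S‖) (fun x hx => ?_) (fun x hx => ?_)
    · exact hσc.aestronglyMeasurable.mul ((S.continuous.comp_aestronglyMeasurable hVm).inner hVm)
    · rw [abs_mul, abs_pow, abs_norm]
      calc |σ x| * |⟪S (V x), V x⟫| ≤ Cσ * (‖S (V x)‖ * ‖V x‖) :=
            mul_le_mul (hsx x) (abs_real_inner_le_norm _ _) (abs_nonneg _) hCσ0
        _ ≤ Cσ * ((‖S‖ * ‖V x‖) * ‖V x‖) :=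
            mul_le_mul_of_nonneg_left (mul_le_mul_of_nonneg_right (S.le_opNorm _) (norm_nonneg _)) hCσ0
        _ = Cσ * ‖S‖ * ‖V x‖ ^ 2 := by ring
    · simp [hσK x hx]
  have hIlimi : Integrable Ilim volume := by
    have h : Integrable (fun x => (1 / 2 : ℝ) * (‖V x‖ ^ 2 * fderiv ℝ σ x (V x)) + P x * fderiv ℝ σ x (V x) +
        γ * ((1 / 2 : ℝ) * (‖V x‖ ^ 2 * fderiv ℝ σ x x)) + (5 / 2 * γ - 1) * (σ x * ‖V x‖ ^ 2) +
        ((1 / 2 : ℝ) * (‖V x‖ ^ 2 * fderiv ℝ σ x (S x)) + σ x * ⟪S (V x), V x⟫)) volume :=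
      ((((hj1.const_mul _).add hj2).add ((hj3.const_mul _).const_mul _)).add (hj4.const_mul _)).add
        ((hj5.const_mul _).add hj6)
    refine (integrable_congr (Eventually.of_forall fun x => ?_)).1 h
    rw [hIlimdef]; ring
  have hIlim_eq : ∫ x, Ilim x = (1 / 2 : ℝ) * (∫ x, ‖V x‖ ^ 2 * fderiv ℝ σ x (V x)) +
      (∫ x, P x * fderiv ℝ σ x (V x)) + γ / 2 * (∫ x, ‖V x‖ ^ 2 * fderiv ℝ σ x x) +
      (5 / 2 * γ - 1) * (∫ x, σ x * ‖V x‖ ^ 2) +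
      (1 / 2 : ℝ) * (∫ x, ‖V x‖ ^ 2 * fderiv ℝ σ x (S x)) + ∫ x, σ x * ⟪S (V x), V x⟫ := by
    have e : ∀ x, Ilim x = (1 / 2 : ℝ) * (‖V x‖ ^ 2 * fderiv ℝ σ x (V x)) + P x * fderiv ℝ σ x (V x) +
        γ / 2 * (‖V x‖ ^ 2 * fderiv ℝ σ x x) + (5 / 2 * γ - 1) * (σ x * ‖V x‖ ^ 2) +
        (1 / 2 : ℝ) * (‖V x‖ ^ 2 * fderiv ℝ σ x (S x)) + σ x * ⟪S (V x), V x⟫ := fun x => by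
      rw [hIlimdef]; ring
    rw [integral_congr_ae (Eventually.of_forall e), integral_add, integral_add, integral_add, integral_add,
      integral_add, integral_const_mul, integral_const_mul, integral_const_mul, integral_const_mul]
    · exact (hj1.const_mul _)
    · exact hj2
    · exact (hj1.const_mul _).add hj2
    · exact hj3.const_mul _
    · exact ((hj1.const_mul _).add hj2).add (hj3.const_mul _)
    · exact hj4.const_mul _
    · exact (((hj1.const_mul _).add hj2).add (hj3.const_mul _)).add (hj4.const_mul _)
    · exact hj5.const_mul _
    · exact ((((hj1.const_mul _).add hj2).add (hj3.const_mul _)).add (hj4.const_mul _)).add (hj5.const_mul _)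
    · exact hj6
  -- ### the limit passage: `∫ Ilim = 0`
  /- ### Step 5. The limit passage -/
  have hkey : ∫ x, Ilim x = 0 := by
    -- the weight
    obtain ⟨DWS, hDWSdef⟩ : ∃ f : ℕ → EuclideanSpace ℝ (Fin 3) → ℝ,
        f = fun n => S₀.indicator fun x => ‖fderiv ℝ (W n) x‖ := ⟨_, rfl⟩
    have hDWS0 : ∀ n x, 0 ≤ DWS n x := fun n x => by
      rw [hDWSdef]
      exact indicator_nonneg (fun y _ => norm_nonneg _) x
    have hDWSS : ∀ n, ∀ x ∈ S₀, DWS n x = ‖fderiv ℝ (W n) x‖ := fun n x hx => by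
      rw [hDWSdef]
      exact indicator_of_mem hx _
    have hDWSout : ∀ n, ∀ x, x ∉ S₀ → DWS n x = 0 := fun n x hx => by
      rw [hDWSdef]
      exact indicator_of_notMem hx _
    have hDWSm : ∀ n, AEStronglyMeasurable (DWS n) volume := fun n => by
      rw [hDWSdef]
      exact ((hDWc n).norm.aestronglyMeasurable).indicator hSm
    have hDW2' : ∀ n, (φ n).rOut ≤ 1 → eLpNorm (DWS n) 2 volume ≤ eLpNorm G 2 (volume.restrict B) := by
      intro n hn; rw [hDWSdef]; exact hDW2 n hn
    set a5 : ℝ := 3 / 2 * |γ| * Cσ' * R + |4 * γ - 1| * Cσ + 3 / 2 * |γ| * Cσ + (3 / 2 * Cσ' * ‖S‖ * R + Cσ * ‖S‖)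
      with ha5
    set a6 : ℝ := 1 / 2 * |γ| * Cσ' * R + 3 / 2 * |γ| * Cσ + 1 / 2 * Cσ' * ‖S‖ * R with ha6
    set a7 : ℝ := |γ| * Cσ * R + Cσ * ‖S‖ * R with ha7
    obtain ⟨Ψ, hΨdef⟩ : ∃ f : ℕ → EuclideanSpace ℝ (Fin 3) → ℝ, f = fun n x =>
      3 / 2 * Cσ' * ‖Vt x‖ ^ 2 + 1 / 2 * Cσ' * (‖Vt x‖ * ‖W n x‖) + Cσ * (DWS n x * ‖Vt x‖) + Cσ' * |Pt x| +
        a5 * ‖Vt x‖ + a6 * ‖W n x‖ + a7 * DWS n x := ⟨_, rfl⟩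
    have hΨ0 : ∀ n x, 0 ≤ Ψ n x := fun n x => by
      have := hDWS0 n x; rw [hΨdef]; positivity
    have hVtm : AEStronglyMeasurable Vt volume := hVt3.1
    have hPtm : AEStronglyMeasurable Pt volume := hPt32.1
    have hWm : ∀ n, AEStronglyMeasurable (W n) volume := fun n => (hWc n).aestronglyMeasurable
    have hΨm : ∀ n, AEStronglyMeasurable (Ψ n) volume := by
      intro n
      rw [hΨdef]
      refine ((((((?_ : AEStronglyMeasurable _ volume).add ?_).add ?_).add ?_).add ?_).add ?_).add ?_
      · exact (hVtm.norm.pow 2).const_mul _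
      · exact (hVtm.norm.mul (hWm n).norm).const_mul _
      · exact ((hDWSm n).mul hVtm.norm).const_mul _
      · exact (continuous_abs.comp_aestronglyMeasurable hPtm).const_mul _
      · exact hVtm.norm.const_mul _
      · exact (hWm n).norm.const_mul _
      · exact (hDWSm n).const_mul _
    -- the pointwise bound
    have hpt2 : ∀ᶠ n in atTop, ∀ x, |In n x - Ilim x| ≤ Ψ n x * ‖(W n - Vt) x‖ := by
      filter_upwards [hr1] with n hn x
      by_cases hx : x ∈ K
      · have h := abs_integrandN_sub_integrandLim_le (γ := γ) (x := x) (v := V x) (w := W n x)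
          (D := fderiv ℝ (W n) x) (d := fderiv ℝ σ x) (s := σ x) (p := P x) (C := Cσ) (C' := Cσ') (R := R)
          (hCσ' x) (hsx x) (hxK x hx) hCσ0 hCσ'0 hRpos.le
        have h' := abs_spiralExtra_sub_le (x := x) (v := V x) (w := W n x) (D := fderiv ℝ (W n) x) (S := S)
          (d := fderiv ℝ σ x) (s := σ x) (C := Cσ) (C' := Cσ') (R := R)
          (hCσ' x) (hsx x) (hxK x hx) hCσ0 hCσ'0 hRpos.le
        rw [← spiralExtra_sub x (V x) (W n x) (fderiv ℝ (W n) x) S (fderiv ℝ σ x) (σ x)] at h'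
        rw [hIndef, hIlimdef]
        beta_reduce
        rw [integrandS_split γ x (V x) (W n x) (fderiv ℝ (W n) x) (fderiv ℝ σ x) (σ x) (P x) S]
        refine ((abs_add_le _ _).trans (add_le_add h h')).trans (le_of_eq ?_)
        rw [hΨdef, Pi.sub_apply]
        beta_reduce
        rw [hVtB x (hKB hx), hPtB x (hKB hx), hDWSS n x (hKS hx), ha5, ha6, ha7]
        ring
      · have h1 : In n x = 0 := by
          rw [hIndef]; simp [hDσK x hx, hσK x hx]
        have h2 : Ilim x = 0 := by
          rw [hIlimdef]; simp [hDσK x hx, hσK x hx]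
        rw [h1, h2, sub_zero, abs_zero]
        exact mul_nonneg (hΨ0 n x) (norm_nonneg _)
    -- the uniform bound
    have hNS : eLpNorm (S₀.indicator fun _ : EuclideanSpace ℝ (Fin 3) => (1 : ℝ)) 6 volume < ⊤ := by
      rw [eLpNorm_indicator_const hSm (by norm_num) (by norm_num)]
      exact ENNReal.mul_lt_top (by simp) (ENNReal.rpow_lt_top_of_nonneg (by norm_num) measure_ball_lt_top.ne)
    obtain ⟨M, hMdef⟩ : ∃ M : ℝ≥0∞, M = ‖3 / 2 * Cσ'‖ₑ * eLpNorm Vt 3 volume ^ 2 +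
        ‖1 / 2 * Cσ'‖ₑ * (eLpNorm Vt 3 volume * eLpNorm Vt 3 volume) +
        ‖Cσ‖ₑ * (eLpNorm G 2 (volume.restrict B) * eLpNorm Vt 6 volume) +
        ‖Cσ'‖ₑ * eLpNorm Pt (3 / 2 : ℝ≥0∞) volume + ‖a5‖ₑ * eLpNorm Vt (3 / 2 : ℝ≥0∞) volume +
        ‖a6‖ₑ * eLpNorm Vt (3 / 2 : ℝ≥0∞) volume +
        ‖a7‖ₑ * (eLpNorm G 2 (volume.restrict B) *
          eLpNorm (S₀.indicator fun _ : EuclideanSpace ℝ (Fin 3) => (1 : ℝ)) 6 volume) := ⟨_, rfl⟩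
    have hM : M ≠ ⊤ := by
      have hN3 := hVt3.eLpNorm_lt_top
      have hN6 := hVt6.eLpNorm_lt_top
      have hN32 := hVt32.eLpNorm_lt_top
      have hNP := hPt32.eLpNorm_lt_top
      have h1 : eLpNorm Vt 3 volume ^ 2 < ⊤ := ENNReal.pow_lt_top hN3
      have h2 := ENNReal.mul_lt_top hNG hN6
      have h3 := ENNReal.mul_lt_top hNG hNS
      have h4 := ENNReal.mul_lt_top hN3 hN3
      rw [hMdef]
      refine (ENNReal.add_lt_top.2 ⟨ENNReal.add_lt_top.2 ⟨ENNReal.add_lt_top.2 ⟨ENNReal.add_lt_top.2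
        ⟨ENNReal.add_lt_top.2 ⟨ENNReal.add_lt_top.2 ⟨?_, ?_⟩, ?_⟩, ?_⟩, ?_⟩, ?_⟩, ?_⟩).ne
      all_goals exact ENNReal.mul_lt_top enorm_lt_top (by assumption)
    have hΨM : ∀ᶠ n in atTop, eLpNorm (Ψ n) (3 / 2 : ℝ≥0∞) volume ≤ M := by
      filter_upwards [hr1] with n hn
      rw [hΨdef, hMdef]
      exact eLpNorm_weight_le hSm hVtm (hWm n) (hDWSm n) hPtm (hDWSout n) (hDW2' n hn) (hW3 n) (hW32 n)
        _ _ _ _ _ _ _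
    -- the limit
    have hgm : ∀ n, AEStronglyMeasurable (W n - Vt) volume := fun n => (hWm n).sub hVtm
    exact integral_eq_zero_of_limit hIn hIlimi hΨm hgm hΨ0 hpt2 hΨM hM hlim
  -- ### conclusion
  have hg1 : ∫ x, (‖V x‖ ^ 2 + 2 * P x) * ⟪V x, gradient σ x⟫ =
      (∫ x, ‖V x‖ ^ 2 * fderiv ℝ σ x (V x)) + 2 * ∫ x, P x * fderiv ℝ σ x (V x) := by
    have e : ∀ x, (‖V x‖ ^ 2 + 2 * P x) * ⟪V x, gradient σ x⟫ =
        ‖V x‖ ^ 2 * fderiv ℝ σ x (V x) + 2 * (P x * fderiv ℝ σ x (V x)) := fun x => by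
      simp only [inner_gradient_eq_fderiv_apply]; ring
    rw [integral_congr_ae (Eventually.of_forall e), integral_add hj1 (hj2.const_mul 2), integral_const_mul]
  have hg2 : ∫ x, ‖V x‖ ^ 2 * ⟪x, gradient σ x⟫ = ∫ x, ‖V x‖ ^ 2 * fderiv ℝ σ x x :=
    integral_congr_ae (Eventually.of_forall fun x => by simp only [inner_gradient_eq_fderiv_apply])
  have hg3 : ∫ x, ‖V x‖ ^ 2 * ⟪S x, gradient σ x⟫ = ∫ x, ‖V x‖ ^ 2 * fderiv ℝ σ x (S x) :=
    integral_congr_ae (Eventually.of_forall fun x => by simp only [inner_gradient_eq_fderiv_apply])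
  rw [hg1, hg2, hg3]
  rw [hIlim_eq] at hkey
  linarith

end Main

end Spiral

end Summit.NavierStokesRegularity.NavierStokesRegularity.Theorems.PowerGaugeEulerLiouville
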